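import Summits.ValiantsHypothesis.ValiantsHypothesis.Theses.FermionizationDimension
import Summits.ValiantsHypothesis.ValiantsHypothesis.Theorems.FermionizationDimensionSDimPerNotQPExpansionBound

/-!
# Route FermionizationDimension — crux `SDimPerNotQP` (stmt-ValiantsHypothesis-7286):
# super-polynomial twisted-determinantal rank forces `SDimUnbounded`

Auxiliary registered stub `stub_superpolyTransfer` of the line `registered` of
`Cruxes/SDimPerNotQP/Lines/birth.lean`: cross-crux glue produced by the line's calibration. If the
twisted-determinantal rank of the permanent eventually exceeds every polynomial (for every `C`,
`tdr(per_n) > n^C` for all large `n`; e.g. a consequence of the sibling crux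
`TwistedDetRank.DirectSumExp`, which gives `tdr(per_n) ≥ 2^(c⌊n/3⌋)`), then the route's crux
`SDimUnbounded` (stmt-ValiantsHypothesis-7288: `s(n) → ∞`) holds: a realisation of `sgn_n` of
dimension `d ≤ s₀` gives `tdr(per_n) ≤ (n+1)^d d^d ≤ (n+1)^(s₀) s₀^(s₀) ≤ n^(s₀+1)` once
`n ≥ 2^(s₀) s₀^(s₀)` (`stub_expansionBound`, Theorems/FermionizationDimensionSDimPerNotQPExpansionBound.lean).

Sources: folklore.
-/

-- `Summit.<Summit>.<Problem>` repeats `ValiantsHypothesis` by the tree's layout convention (D-0017).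
set_option linter.dupNamespace false

namespace Summit.ValiantsHypothesis.ValiantsHypothesis.Theorems

namespace FermionizationDimensionSDimPerNotQPSuperpolyTransfer

/-- A commutative realisation of the sign character lives on a nontrivial algebra: its dimension
is positive (`ℓ 1 = sgn 1 = 1 ≠ 0`). [folklore] -/
theorem finrank_pos_of_realisation {n : ℕ} {R : Type} [CommRing R] [Algebra ℂ R]
    [Module.Finite ℂ R] (u : Fin n → Fin n → R) (ℓ : R →ₗ[ℂ] ℂ)
    (hu : ∀ σ : Equiv.Perm (Fin n), ℓ (∏ i, u (σ i) i) = ((Equiv.Perm.sign σ : ℤ) : ℂ)) :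
    0 < Module.finrank ℂ R := by
  rcases Nat.eq_zero_or_pos (Module.finrank ℂ R) with h0 | hpos
  · exfalso
    have hR : ∀ x : R, x = 0 := finrank_zero_iff_forall_zero.1 h0
    have h1 := hu 1
    rw [hR (∏ i, u ((1 : Equiv.Perm (Fin n)) i) i), map_zero] at h1
    simp at h1
  · exact hpos

/-- Arithmetic: for `1 ≤ d ≤ s₀` and `2^(s₀) s₀^(s₀) ≤ n`, `(n+1)^d d^d ≤ n^(s₀+1)`. [folklore] -/
theorem pow_mul_pow_le_pow_succ (n d s₀ : ℕ) (hd1 : 1 ≤ d) (hd : d ≤ s₀)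
    (hn : 2 ^ s₀ * s₀ ^ s₀ ≤ n) : (n + 1) ^ d * d ^ d ≤ n ^ (s₀ + 1) := by
  have hs : 1 ≤ s₀ := hd1.trans hd
  have h1 : (n + 1) ^ d ≤ (n + 1) ^ s₀ := Nat.pow_le_pow_right (Nat.succ_pos n) hd
  have h2 : d ^ d ≤ s₀ ^ s₀ :=
    (Nat.pow_le_pow_left hd d).trans (Nat.pow_le_pow_right hs hd)
  have hn1 : 1 ≤ n :=
    le_trans (Nat.one_le_iff_ne_zero.2
      (Nat.mul_ne_zero (pow_ne_zero _ two_ne_zero) (pow_ne_zero _ (by omega)))) hn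
  have h3 : (n + 1) ^ s₀ ≤ 2 ^ s₀ * n ^ s₀ := by
    rw [← mul_pow]
    exact Nat.pow_le_pow_left (by omega) s₀
  calc (n + 1) ^ d * d ^ d ≤ (n + 1) ^ s₀ * s₀ ^ s₀ := Nat.mul_le_mul h1 h2
    _ ≤ 2 ^ s₀ * n ^ s₀ * s₀ ^ s₀ := Nat.mul_le_mul_right _ h3
    _ = (2 ^ s₀ * s₀ ^ s₀) * n ^ s₀ := by ring
    _ ≤ n * n ^ s₀ := Nat.mul_le_mul_right _ hn
    _ = n ^ (s₀ + 1) := by ring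

end FermionizationDimensionSDimPerNotQPSuperpolyTransfer

open FermionizationDimensionSDimPerNotQPSuperpolyTransfer in
/-- **Super-polynomial `tdr` gives `SDimUnbounded`** (auxiliary registered stub
`stub_superpolyTransfer` of the line `registered` of crux `SDimPerNotQP`, stmt-ValiantsHypothesis-7286):
if the twisted-determinantal rank of the permanent eventually exceeds every polynomial, then the
commutative twisting dimension of the permanent tends to infinity (the route's crux
`SDimUnbounded`, stmt-ValiantsHypothesis-7288, BY NAME). [folklore] -/
theorem stub_superpolyTransfer :
    (∀ C : ℕ, ∃ n₀ : ℕ, ∀ n ≥ n₀, ∀ (r : ℕ) (E : Fin r → Matrix (Fin n) (Fin n) ℂ), Literature.Computability.AlgebraicComplexity.perPoly (Fin n) ℂ = ∑ t, (Matrix.of fun i j => MvPolynomial.C (E t i j) * MvPolynomial.X (i, j)).det → n ^ C < r) → Summit.ValiantsHypothesis.ValiantsHypothesis.Theses.FermionizationDimension.SDimUnbounded := by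
  intro hsp s₀
  obtain ⟨n₁, hn₁⟩ := hsp (s₀ + 1)
  refine ⟨max n₁ (2 ^ s₀ * s₀ ^ s₀), fun n hn R _ _ _ u ℓ hu => ?_⟩
  by_contra hle
  have hd : Module.finrank ℂ R ≤ s₀ := Nat.le_of_not_lt hle
  have hd1 : 1 ≤ Module.finrank ℂ R := finrank_pos_of_realisation u ℓ hu
  obtain ⟨r, hr, E, hE⟩ := stub_expansionBound n R u ℓ hu
  have hlt : n ^ (s₀ + 1) < r := hn₁ n (le_of_max_le_left hn) r E hE
  have hle' : r ≤ n ^ (s₀ + 1) :=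
    hr.trans (pow_mul_pow_le_pow_succ n _ s₀ hd1 hd (le_of_max_le_right hn))
  omega

end Summit.ValiantsHypothesis.ValiantsHypothesis.Theorems
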